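import Summits.HodgeConjecture.HodgeConjecture.Theorems.F0P2oThetaTypeJacquetSocketSpelling   -- ★ p835111 A-p12 (g17): the letter-(a) socket in the closer's spelling
import Summits.HodgeConjecture.HodgeConjecture.Theorems.F0P2oN3TorusWeightHolds            -- ★ p836093 A-p16 (g24): N3 ⟸ clause (a) alone (`thetaType_nonsplit_jacquetModule_of_a`)
import HarnessLib

/-!
# Crux `H413`, programme P2, N3 road (a) — THE CLAUSE-(a) CLOSER OVER THE (E5) DICTIONARY STATEMENT:
# `stub_N3a_letter` and the print letter #96 `GelbartRogawski1991.thetaType_nonsplit_jacquetModule` from ONE ∀-closed dictionary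

Cell hodgecm-mathlib (D-0151), FLOOR 0, crux item H413 = stmt-HodgeConjecture-24833, programme P2; N3 road (a) of the K1∕N3 lead B-p18 (g29)
(LEAD DEALING 2026-08-31T23:08:02Z, row (α)); seat F0P2-p02 (g7).  THEOREMS ONLY; no `Cruxes/…/Lines` import; kernel lane
`--supports stmt-HodgeConjecture-24833 --as helper`.  HC_CM is proved only modulo the 2 remaining named inputs (hLiu418, h413) — behind them the booked printed
statements + the MOD package — until rung 0 closes; this file proves no letter by itself: it is the ONE-TOKEN FOLD TARGET of `stub_N3a_letter` (T7 v1.5 ∕ PKΠ v1.12 ∕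
K1 v3e ∕ parent v1.4, the only P2 local print residue below the packet letters) the minute F0P2-p01 (g8)'s (E5)
`Theorems/F0P2oLineWeilDictionary.lean :: exists_dictionary` is ★ — its statement, ∀-closed over the (E4) binders, is the hypothesis `hE5` below, TOKEN FOR TOKEN
the `(π, hπ, hker, σ, hσ, Tr, hTr)` package of ★ p835111 `F0P2oThetaTypeJacquetSocketSpelling.nonempty_jacquet_xThetaGqsCM_equiv_weightSpace_of_continuous′` with the character
pinned to `μ_v⁻¹ ∘ det` (lead «=» 22:45:27Z (4): the (a)-side TARGET OF RECORD).

* `stubN3a_of_dictionary (hE5) : ‹hA›` — clause (a) «`r_N(X_v) ≃ ℱ_v[ψθ]`» ∀-closed over the letter's binders (= the first binder `hA` of ★ p835661 ∕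
  ★ p836093, = the desk's `stub_N3a_letter` type, token for token), from the dictionary by ONE application of the socket per datum;
* `thetaType_nonsplit_jacquetModule_of_dictionary (hE5) : GelbartRogawski1991.thetaType_nonsplit_jacquetModule` — the print letter #96 over ★ p836093
  `thetaType_nonsplit_jacquetModule_of_a` (clause (b) is ★ in the tree: (D3d) chain p834000 … p836093).

[GelbartRogawski1991 §3.2 (3.2.1)–(3.2.3) p. 457; Kudla1986 Thm. 2.8; MoeglinVignerasWaldspurger1987 Chap. 3 §IV.5.]

## References
* [GelbartRogawski1991] S. Gelbart, J. Rogawski, Invent. Math. 105 (1991): §3.2 (3.2.1)–(3.2.3) p. 457; §5.2 p. 467 L25–27.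
* [Kudla1986] S. Kudla, Invent. Math. 83 (1986): Thm. 2.8.
* [MoeglinVignerasWaldspurger1987] C. Mœglin, M.-F. Vignéras, J.-L. Waldspurger, LNM 1291 (1987): Chap. 2 II.1; Chap. 3 §IV.5.
-/

set_option autoImplicit false
-- the mandated namespace repeats the single-problem summit's segment (`HodgeConjecture.HodgeConjecture`)
set_option linter.dupNamespace false

noncomputable section

open NumberField IsDedekindDomain
open scoped Matrix Kronecker
open Literature.RepresentationTheory Literature.NumberTheory.Automorphic Representation
open Literature.NumberTheory Literature.NumberTheory.Automorphic.UnitaryGroup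
open Literature.NumberTheory.Automorphic.IdeleClassGroup
open Literature.NumberTheory.Automorphic.Liu2021 Literature.NumberTheory.Automorphic.Liu2021.Def411WeilCarriers
open Literature.NumberTheory.GelbartRogawski1991 Literature.NumberTheory.GelbartRogawski1991.UnitaryDualPair
open Literature.NumberTheory.GelbartRogawski1991.UnitaryDualPair.WeilCoinv Literature.NumberTheory.GelbartRogawski1991.UnitaryDualPair.LocalSplitting
open Literature.NumberTheory.GaloisRepresentations Literature.NumberTheory.Rogawski1990
open Literature.RepresentationTheory.Liu2021 Literature.RepresentationTheory.HeisenbergGroup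
open Summit.HodgeConjecture.HodgeConjecture.Cruxes.H413.F0P2oThetaTypeJacquetSocketSpelling
open Summit.HodgeConjecture.HodgeConjecture.Cruxes.H413.F0P2oN3TorusWeightHolds

namespace Summit.HodgeConjecture.HodgeConjecture.Cruxes.H413.F0P2oN3ClauseAOfDictionary

set_option synthInstance.maxHeartbeats 400000 in
set_option maxHeartbeats 16000000 in
/-- **CLAUSE (a) OF N3 FROM THE (E5) DICTIONARY.**  `hE5` = F0P2-p01 (g8)'s (E5) `F0P2oLineWeilDictionary.exists_dictionary` ∀-closed over the (E4) binders
(`L e₁ dV hdV hdV0 e₀ μ hμ ε v hv T a ha h`): a surjection `π : 𝒮(L⁺_v^{n′}) → 𝒮(L⁺_v)` with kernel the `N`-coinvariant kernel of the restricted Weil representation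
(closer's spelling `toRep ∘ s_v ∘ localLineInl ∘ localPiEquiv⁻¹ ∘ cmDatumLocalCongr T`), a representation `σ` of `U((ε))(L⁺_v)` through which the centre descends
(`π (ω(s_v (localCenter u)) f) = σ u (π f)`), and a model matching `Tr : 𝒮(L⁺_v) ≃ 𝒮(L⁺_v^{n₀})` onto GR's `ω¹(γ_v, ψ_v) = lineWeilCM … (kernelLineCM dV) … ε v` with the
character PINNED to `μ_v(det u)⁻¹`.  Conclusion = clause (a) of ★ `thetaType_nonsplit_jacquetModule` ∀-closed over the letter's binders — the first binder `hA` of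
★ p835661 ∕ ★ p836093 and the desk's `stub_N3a_letter`, token for token — by ONE application of ★ p835111
`nonempty_jacquet_xThetaGqsCM_equiv_weightSpace_of_continuous′` per datum `(χf, ψθ)`.
[cite: GelbartRogawski1991, §3.2 (3.2.1)–(3.2.3) p. 457; §5.2 p. 467 L25–27] [cite: Kudla1986, Thm. 2.8] [cite: MoeglinVignerasWaldspurger1987, Chap. 3 §IV.5] -/
theorem stubN3a_of_dictionary
    (hE5 : ∀ (L : Type) [Field L] [NumberField L] [IsCMField L]
      {n' : ℕ} (e₁ : Fin 3 × Fin 1 ≃ Fin n') (dV : Fin 3 → L) (hdV : ∀ i, IsCMField.complexConj L (dV i) = dV i) (hdV0 : ∀ i, dV i ≠ 0)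
      {n₀ : ℕ} (e₀ : Fin 1 × Fin 1 ≃ Fin n₀)
      (μ : Literature.NumberTheory.Automorphic.IdeleClassGroup L →ₜ* Circle) (hμ : IsConjugateSymplectic L μ)
      (ε : (↥(maximalRealSubfield L))ˣ) (v : HeightOneSpectrum (𝓞 ↥(maximalRealSubfield L))),
      (∀ w : PlacesOver L v, IsCMField.complexConj L • w.1 = w.1) →
      ∀ (T : GL (Fin 3) (UnitaryGroup.LocalRing L v)) {a : UnitaryGroup.LocalRing L v} (ha : IsUnit a)
        (h : formCongr (conjLocal L (IsCMField.complexConj L) v) T ((Matrix.diagonal dV).map (algebraMap L (UnitaryGroup.LocalRing L v))) =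
          a • (Matrix.of fun i j : Fin 3 => if i.val + j.val + 1 = 3 then (1 : L) else 0).map (algebraMap L (UnitaryGroup.LocalRing L v))),
      ∃ (π : SchwartzBruhat (Fin n' → v.adicCompletion ↥(maximalRealSubfield L)) →ₗ[ℂ]
            SchwartzBruhat (Fin 1 → v.adicCompletion ↥(maximalRealSubfield L)))
        (σ : Representation ℂ (localPi L (IsCMField.complexConj L) 1 (JW (↥(maximalRealSubfield L)) L ε) v)
            (SchwartzBruhat (Fin 1 → v.adicCompletion ↥(maximalRealSubfield L))))
        (Tr : SchwartzBruhat (Fin 1 → v.adicCompletion ↥(maximalRealSubfield L)) ≃ₗ[ℂ]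
            SchwartzBruhat (Fin n₀ → v.adicCompletion ↥(maximalRealSubfield L))),
        Function.Surjective π ∧
        LinearMap.ker π = Coinvariants.ker
          ((((MpPsi.toRep (localSchrodinger (↥(maximalRealSubfield L)) n'
              (gram (↥(maximalRealSubfield L)) e₁ (realDiagonal L dV hdV) (TW (↥(maximalRealSubfield L)) ε)) v)).comp
            ((chiLocalSplittingsCM L e₁ dV hdV hdV0 (toHeckeCharacter L μ) ((isOscillatorChar_toHeckeCharacter_iff μ).mpr hμ) ε).s v)).comp
            ((localLineInl L (IsCMField.complexConj L) 3 e₁ (Matrix.diagonal dV) (JW (↥(maximalRealSubfield L)) L ε) v).comp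
              ((localPiEquiv L (IsCMField.complexConj L) 3 (Matrix.diagonal dV) v).symm.toMonoidHom.comp
                (cmDatumLocalCongr L v T ha h).toMonoidHom))).comp (cmBorelTriple L 3 v).N.subtype) ∧
        (∀ (u : localPi L (IsCMField.complexConj L) 1 (JW (↥(maximalRealSubfield L)) L ε) v)
          (f : SchwartzBruhat (Fin n' → v.adicCompletion ↥(maximalRealSubfield L))),
          π (MpPsi.toRep (localSchrodinger (↥(maximalRealSubfield L)) n'
              (gram (↥(maximalRealSubfield L)) e₁ (realDiagonal L dV hdV) (TW (↥(maximalRealSubfield L)) ε)) v)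
            ((chiLocalSplittingsCM L e₁ dV hdV hdV0 (toHeckeCharacter L μ) ((isOscillatorChar_toHeckeCharacter_iff μ).mpr hμ) ε).s v
              (localCenter L (IsCMField.complexConj L) n' (Matrix.reindex e₁ e₁ (Matrix.diagonal dV ⊗ₖ JW (↥(maximalRealSubfield L)) L ε))
                (JW (↥(maximalRealSubfield L)) L ε) (JW_apply_ne_zero (↥(maximalRealSubfield L)) L ε) v u)) f) = σ u (π f)) ∧
        ∀ (u : localPi L (IsCMField.complexConj L) 1 (JW (↥(maximalRealSubfield L)) L ε) v)
          (s : SchwartzBruhat (Fin 1 → v.adicCompletion ↥(maximalRealSubfield L))),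
          lineWeilCM L e₀ (kernelLineCM dV) (complexConj_kernelLineCM dV hdV) (kernelLineCM_ne_zero dV hdV0) μ hμ ε v u (Tr s) =
            ((((toHeckeCharacter L μ).semilocalComponent L v
              ((localDet (IsCMField.complexConj L) v
                (isUnit_iff_ne_zero.mpr (by rw [Matrix.det_fin_one]; exact JW_apply_ne_zero (↥(maximalRealSubfield L)) L ε))
                (localPiEquiv L (IsCMField.complexConj L) 1 (JW (↥(maximalRealSubfield L)) L ε) v u) :
                  ↥(normOneUnits (conjLocal L (IsCMField.complexConj L) v))) : (UnitaryGroup.LocalRing L v)ˣ))⁻¹ : ℂˣ) : ℂ) • Tr (σ u s)) :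
    ∀ (L : Type) [Field L] [NumberField L] [IsCMField L]
      {n' : ℕ} (e₁ : Fin 3 × Fin 1 ≃ Fin n') (dV : Fin 3 → L) (hdV : ∀ i, IsCMField.complexConj L (dV i) = dV i) (hdV0 : ∀ i, dV i ≠ 0)
      {n₀ : ℕ} (e₀ : Fin 1 × Fin 1 ≃ Fin n₀)
      (μ : Literature.NumberTheory.Automorphic.IdeleClassGroup L →ₜ* Circle) (hμ : IsConjugateSymplectic L μ)
      (χf : UnitaryGroup.finAdelicOne (↥(maximalRealSubfield L)) L (IsCMField.complexConj L) →* ℂˣ),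
      Continuous χf → (∀ z, ‖((χf z : ℂˣ) : ℂ)‖ = 1) →
      ∀ (v : HeightOneSpectrum (𝓞 ↥(maximalRealSubfield L))),
        (∀ w : PlacesOver L v, IsCMField.complexConj L • w.1 = w.1) →
        ∀ (ε : (↥(maximalRealSubfield L))ˣ) (ψθ : ↥(normOneUnits (conjLocal L (IsCMField.complexConj L) v)) →* ℂˣ),
          IsThetaCenterChar L μ χf ε v ψθ →
          ∀ (T : GL (Fin 3) (UnitaryGroup.LocalRing L v)) (a : UnitaryGroup.LocalRing L v) (ha : IsUnit a)
            (h : formCongr (conjLocal L (IsCMField.complexConj L) v) T ((Matrix.diagonal dV).map (algebraMap L (UnitaryGroup.LocalRing L v))) =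
              a • (Matrix.of fun i j : Fin 3 => if i.val + j.val + 1 = 3 then (1 : L) else 0).map (algebraMap L (UnitaryGroup.LocalRing L v))),
            Nonempty (((cmBorelTriple L 3 v).restrict (xThetaGqsCM L e₁ dV hdV hdV0 μ hμ χf ε v T ha h)).Coinvariants ≃ₗ[ℂ]
              ↥(weightSpace (lineWeilCM L e₀ (kernelLineCM dV) (complexConj_kernelLineCM dV hdV) (kernelLineCM_ne_zero dV hdV0) μ hμ ε v) id
                (fun u => ((ψθ (localDet (IsCMField.complexConj L) v
                  (isUnit_iff_ne_zero.mpr (by rw [Matrix.det_fin_one]; exact JW_apply_ne_zero (↥(maximalRealSubfield L)) L ε))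
                  (localPiEquiv L (IsCMField.complexConj L) 1 (JW (↥(maximalRealSubfield L)) L ε) v u)) : ℂˣ) : ℂ)))) := by
  intro L _ _ _ n' e₁ dV hdV hdV0 n₀ e₀ μ hμ χf hχc _hχu v hv ε ψθ hψθ T a ha h
  have h5 := hE5 L e₁ dV hdV hdV0 e₀ μ hμ ε v hv T ha h
  obtain ⟨π, σ, Tr, hπ, hker, hσ, hTr⟩ := h5
  exact nonempty_jacquet_xThetaGqsCM_equiv_weightSpace_of_continuous' L e₁ dV hdV hdV0 e₀ μ hμ χf ε v hv hχc ψθ hψθ T ha h π hπ hker σ hσ Tr hTr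

set_option synthInstance.maxHeartbeats 400000 in
set_option maxHeartbeats 16000000 in
/-- **THE PRINT LETTER #96 `GelbartRogawski1991.thetaType_nonsplit_jacquetModule` FROM THE (E5) DICTIONARY** — clause (a) by `stubN3a_of_dictionary`,
clause (b) ★ in the tree (★ p836093 `thetaType_nonsplit_jacquetModule_of_a` over the (D3d) chain).  The N3 fold of the desk's Lines editions and the
hypothesis-free letter are ONE token each the minute (E5) is ★: `stub_N3a_letter := stubN3a_of_dictionary ‹exists_dictionary›`,
`thetaType_nonsplit_jacquetModule_holds := thetaType_nonsplit_jacquetModule_of_dictionary ‹exists_dictionary›`.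
[cite: GelbartRogawski1991, §3.2 (3.2.1)–(3.2.3) p. 457] [cite: Kudla1986, Thm. 2.8] -/
theorem thetaType_nonsplit_jacquetModule_of_dictionary
    (hE5 : ∀ (L : Type) [Field L] [NumberField L] [IsCMField L]
      {n' : ℕ} (e₁ : Fin 3 × Fin 1 ≃ Fin n') (dV : Fin 3 → L) (hdV : ∀ i, IsCMField.complexConj L (dV i) = dV i) (hdV0 : ∀ i, dV i ≠ 0)
      {n₀ : ℕ} (e₀ : Fin 1 × Fin 1 ≃ Fin n₀)
      (μ : Literature.NumberTheory.Automorphic.IdeleClassGroup L →ₜ* Circle) (hμ : IsConjugateSymplectic L μ)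
      (ε : (↥(maximalRealSubfield L))ˣ) (v : HeightOneSpectrum (𝓞 ↥(maximalRealSubfield L))),
      (∀ w : PlacesOver L v, IsCMField.complexConj L • w.1 = w.1) →
      ∀ (T : GL (Fin 3) (UnitaryGroup.LocalRing L v)) {a : UnitaryGroup.LocalRing L v} (ha : IsUnit a)
        (h : formCongr (conjLocal L (IsCMField.complexConj L) v) T ((Matrix.diagonal dV).map (algebraMap L (UnitaryGroup.LocalRing L v))) =
          a • (Matrix.of fun i j : Fin 3 => if i.val + j.val + 1 = 3 then (1 : L) else 0).map (algebraMap L (UnitaryGroup.LocalRing L v))),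
      ∃ (π : SchwartzBruhat (Fin n' → v.adicCompletion ↥(maximalRealSubfield L)) →ₗ[ℂ]
            SchwartzBruhat (Fin 1 → v.adicCompletion ↥(maximalRealSubfield L)))
        (σ : Representation ℂ (localPi L (IsCMField.complexConj L) 1 (JW (↥(maximalRealSubfield L)) L ε) v)
            (SchwartzBruhat (Fin 1 → v.adicCompletion ↥(maximalRealSubfield L))))
        (Tr : SchwartzBruhat (Fin 1 → v.adicCompletion ↥(maximalRealSubfield L)) ≃ₗ[ℂ]
            SchwartzBruhat (Fin n₀ → v.adicCompletion ↥(maximalRealSubfield L))),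
        Function.Surjective π ∧
        LinearMap.ker π = Coinvariants.ker
          ((((MpPsi.toRep (localSchrodinger (↥(maximalRealSubfield L)) n'
              (gram (↥(maximalRealSubfield L)) e₁ (realDiagonal L dV hdV) (TW (↥(maximalRealSubfield L)) ε)) v)).comp
            ((chiLocalSplittingsCM L e₁ dV hdV hdV0 (toHeckeCharacter L μ) ((isOscillatorChar_toHeckeCharacter_iff μ).mpr hμ) ε).s v)).comp
            ((localLineInl L (IsCMField.complexConj L) 3 e₁ (Matrix.diagonal dV) (JW (↥(maximalRealSubfield L)) L ε) v).comp
              ((localPiEquiv L (IsCMField.complexConj L) 3 (Matrix.diagonal dV) v).symm.toMonoidHom.comp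
                (cmDatumLocalCongr L v T ha h).toMonoidHom))).comp (cmBorelTriple L 3 v).N.subtype) ∧
        (∀ (u : localPi L (IsCMField.complexConj L) 1 (JW (↥(maximalRealSubfield L)) L ε) v)
          (f : SchwartzBruhat (Fin n' → v.adicCompletion ↥(maximalRealSubfield L))),
          π (MpPsi.toRep (localSchrodinger (↥(maximalRealSubfield L)) n'
              (gram (↥(maximalRealSubfield L)) e₁ (realDiagonal L dV hdV) (TW (↥(maximalRealSubfield L)) ε)) v)
            ((chiLocalSplittingsCM L e₁ dV hdV hdV0 (toHeckeCharacter L μ) ((isOscillatorChar_toHeckeCharacter_iff μ).mpr hμ) ε).s v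
              (localCenter L (IsCMField.complexConj L) n' (Matrix.reindex e₁ e₁ (Matrix.diagonal dV ⊗ₖ JW (↥(maximalRealSubfield L)) L ε))
                (JW (↥(maximalRealSubfield L)) L ε) (JW_apply_ne_zero (↥(maximalRealSubfield L)) L ε) v u)) f) = σ u (π f)) ∧
        ∀ (u : localPi L (IsCMField.complexConj L) 1 (JW (↥(maximalRealSubfield L)) L ε) v)
          (s : SchwartzBruhat (Fin 1 → v.adicCompletion ↥(maximalRealSubfield L))),
          lineWeilCM L e₀ (kernelLineCM dV) (complexConj_kernelLineCM dV hdV) (kernelLineCM_ne_zero dV hdV0) μ hμ ε v u (Tr s) =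
            ((((toHeckeCharacter L μ).semilocalComponent L v
              ((localDet (IsCMField.complexConj L) v
                (isUnit_iff_ne_zero.mpr (by rw [Matrix.det_fin_one]; exact JW_apply_ne_zero (↥(maximalRealSubfield L)) L ε))
                (localPiEquiv L (IsCMField.complexConj L) 1 (JW (↥(maximalRealSubfield L)) L ε) v u) :
                  ↥(normOneUnits (conjLocal L (IsCMField.complexConj L) v))) : (UnitaryGroup.LocalRing L v)ˣ))⁻¹ : ℂˣ) : ℂ) • Tr (σ u s)) :
    Literature.NumberTheory.GelbartRogawski1991.thetaType_nonsplit_jacquetModule :=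
  thetaType_nonsplit_jacquetModule_of_a (stubN3a_of_dictionary hE5)

end Summit.HodgeConjecture.HodgeConjecture.Cruxes.H413.F0P2oN3ClauseAOfDictionary

end
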